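import Mathlib
import Summits.ValiantsHypothesis.ValiantsHypothesis.Theorems.BarrierLeverPartitionMinorsHitByVPHiddenStatesSecondShellExchange
import Summits.ValiantsHypothesis.ValiantsHypothesis.Theorems.BarrierLeverPartitionMinorsHitByVPHiddenStatesPathTableTransfer

/-!
# Route BarrierLever — item `PartitionMinorsHitByVP` (stmt-ValiantsHypothesis-19717), line `hidden-states`:
# THE m-SWAP EXCHANGE COMPOSITION — «m first-shell certificates + a uniquely matched zero pattern of cross minors ⇒ an m-th-shell table»

Helper file (`--supports stmt-ValiantsHypothesis-19717`; cell valiant-natproofs, 𝒟-side door (c), registered line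
`Cruxes/PartitionMinorsHitByVP/Lines/hidden_states.lean` v8; prover seat val-np-p6 gen 17).  Closes NO item.  Definitions: the m-parameter
table `tabM` / `tabRM` (transparent abbreviations).

THE MECHANISM (memo HOME/val-np-p6/g17/MEMO-valnp6-g17.md §5), generalising `…SecondShellExchange` from 2 to `m` swaps.  For a base row
enumeration `b` (the ball), `m` distinct slots `idx l` (holding `A_l`) and new rows `C_l`, write `D_B`, `D_U` (all slots replaced) and the
`m × m` matrix of ONE-ROW replacements `D l l' = D_{B − A_l + C_{l'}}`.  Over a field with `D_B ≠ 0`: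
`D_B · det[D l l'] = D_B^m · D_U` (`det_mul_det_oneRow_eq`, Cramer coordinates + «identity with m rows replaced» `det_rows_replaced_one`);
hence the same identity in `ℂ[ε_1..ε_m]` for the m-parameter table `I + Σ_l ε_l N_l` (`detRM_identity`, by evaluation, using `D_B(0) ≠ 0`:
the inclusion matrix of the ball is nonsingular, `det_incl_ne_zero`).  If every non-identity permutation `σ` meets an identically vanishing
cross minor `D_{l, σ l} ≡ 0` (the diagonal is the UNIQUE perfect matching of the possibly-nonzero pattern) and each diagonal minor is nonzero at
`ε = e_l` (the first-shell certificate of swap `l` for ITS table), then `D_U(ε) ≠ 0` for some `ε` (★ `exists_params_of_unique_matching`,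
item-currency form ★ `exists_table_of_unique_matching`).  The sibling `…MultiSwapCells` instantiates this with g16's path tables and immobile tokens.

WHAT THIS IS NOT: no claim about which m-th-shell classes have a uniquely matched zero pattern (census in the memo: 87 % of sampled third-shell
families at t = 3); nothing on crux 14610 or VP ≠ VNP.
-/

set_option linter.dupNamespace false

namespace Summit.ValiantsHypothesis.ValiantsHypothesis.Theorems.BarrierLever.HiddenStates

open Finset

noncomputable section

namespace SecondShell

open PathTable (moebius_zero)
open scoped Matrix

/-! ## Linear algebra: m rows replaced -/

section Field

variable {K : Type*} [Field K] {r m : ℕ}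

/-- **«identity with `m` rows replaced»**: if `P i` is the unit row for `i` outside the slots and `P (idx l) = X l`, then
`det P` is the determinant of the `m × m` block `X l (idx l')`. -/
theorem det_rows_replaced_one (idx : Fin m → Fin r) (hidx : Function.Injective idx) (X : Fin m → Fin r → K)
    (P : Matrix (Fin r) (Fin r) K) (hP1 : ∀ i, (∀ l, idx l ≠ i) → P i = Pi.single i 1) (hP2 : ∀ l, P (idx l) = X l) :
    P.det = (Matrix.of fun l l' : Fin m => X l (idx l')).det := by
  classical
  let e : Fin m ⊕ {i : Fin r // i ∉ Set.range idx} ≃ Fin r :=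
    (Equiv.sumCongr (Equiv.ofInjective idx hidx) (Equiv.refl _)).trans (Equiv.sumCompl fun i => i ∈ Set.range idx)
  have he1 : ∀ l, e (Sum.inl l) = idx l := fun l => by simp [e]
  have he2 : ∀ i : {i : Fin r // i ∉ Set.range idx}, e (Sum.inr i) = i.1 := fun i => by simp [e]
  have hsub : P.submatrix e e = Matrix.fromBlocks (Matrix.of fun l l' : Fin m => X l (idx l'))
      (Matrix.of fun (l : Fin m) (i : {i : Fin r // i ∉ Set.range idx}) => X l i.1) 0 1 := by
    ext x y
    rcases x with l | i <;> rcases y with l' | i'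
    · rw [Matrix.submatrix_apply, he1, he1, hP2, Matrix.fromBlocks_apply₁₁, Matrix.of_apply]
    · rw [Matrix.submatrix_apply, he1, he2, hP2, Matrix.fromBlocks_apply₁₂, Matrix.of_apply]
    · rw [Matrix.submatrix_apply, he2, he1, Matrix.fromBlocks_apply₂₁, Matrix.zero_apply,
        hP1 i.1 (fun l h => i.2 ⟨l, h⟩), Pi.single_apply, if_neg]
      intro h; exact i.2 ⟨l', h⟩
    · rw [Matrix.submatrix_apply, he2, he2, Matrix.fromBlocks_apply₂₂, hP1 i.1 (fun l h => i.2 ⟨l, h⟩), Pi.single_apply,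
        Matrix.one_apply]
      by_cases h : i = i'
      · subst h; simp
      · rw [if_neg (fun h' => h (Subtype.ext h'.symm)), if_neg h]
  rw [← Matrix.det_submatrix_equiv_self e P, hsub, Matrix.det_fromBlocks_zero₂₁, Matrix.det_one, mul_one]

/-- rows of a product: `(P * M) i = P i ᵥ* M`. -/
theorem mul_row_eq_vecMul (P M : Matrix (Fin r) (Fin r) K) (i : Fin r) : (P * M) i = P i ᵥ* M := by
  funext j; simp [Matrix.mul_apply, Matrix.vecMul, dotProduct]

/-- ★ **The m-row exchange identity over a field**: for `M` with `det M ≠ 0`, distinct slots `idx`, new rows `c`, and `N` = `M` with the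
slots replaced, `det M · det[ det(M[idx l ↦ c l']) ]_{l,l'} = (det M)^m · det N`. -/
theorem det_mul_det_oneRow_eq (M : Matrix (Fin r) (Fin r) K) (hM : M.det ≠ 0) (idx : Fin m → Fin r)
    (hidx : Function.Injective idx) (c : Fin m → Fin r → K) (N : Matrix (Fin r) (Fin r) K)
    (hN1 : ∀ i, (∀ l, idx l ≠ i) → N i = M i) (hN2 : ∀ l, N (idx l) = c l) :
    M.det * (Matrix.of fun l l' : Fin m => (M.updateRow (idx l) (c l')).det).det = M.det ^ m * N.det := by
  classical
  have hMu : IsUnit M.det := isUnit_iff_ne_zero.2 hM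
  let X : Fin m → Fin r → K := fun l => c l ᵥ* M⁻¹
  have hX : ∀ l, X l ᵥ* M = c l := fun l => by
    simp only [X, Matrix.vecMul_vecMul, Matrix.nonsing_inv_mul _ hMu, Matrix.vecMul_one]
  -- the matrix `P` with `P * M = N`
  let P : Matrix (Fin r) (Fin r) K := Matrix.of fun i => if h : ∃ l, idx l = i then X (Classical.choose h) else Pi.single i 1
  have hP1 : ∀ i, (∀ l, idx l ≠ i) → P i = Pi.single i 1 := by
    intro i hi; funext j
    simp only [P, Matrix.of_apply]
    rw [dif_neg (fun ⟨l, h⟩ => hi l h)]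
  have hP2 : ∀ l, P (idx l) = X l := by
    intro l; funext j
    simp only [P, Matrix.of_apply]
    have h : ∃ l', idx l' = idx l := ⟨l, rfl⟩
    rw [dif_pos h, hidx (Classical.choose_spec h)]
  have hPM : P * M = N := by
    ext i j
    rw [show (P * M) i j = (P i ᵥ* M) j by rw [mul_row_eq_vecMul]]
    by_cases h : ∃ l, idx l = i
    · obtain ⟨l, rfl⟩ := h
      rw [hP2, hX, hN2]
    · rw [hP1 i (fun l hl => h ⟨l, hl⟩), Matrix.single_vecMul, one_smul, hN1 i (fun l hl => h ⟨l, hl⟩)]; rfl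
  have hdetN : N.det = (Matrix.of fun l l' : Fin m => X l (idx l')).det * M.det := by
    rw [← hPM, Matrix.det_mul, det_rows_replaced_one idx hidx X P hP1 hP2]
  -- Cramer: the one-row minors
  have hD : ∀ l l', (M.updateRow (idx l) (c l')).det = M.det * X l' (idx l) := by
    intro l l'
    have hcr : M.transpose.cramer (c l') = M.det • X l' := by
      have h1 : M.transpose.cramer (c l') ᵥ* M = (M.det • X l') ᵥ* M := by
        rw [← Matrix.mulVec_transpose, Matrix.mulVec_cramer, Matrix.det_transpose, Matrix.smul_vecMul, hX]
      have h2 := congrArg (fun v => v ᵥ* M⁻¹) h1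
      simp only [Matrix.vecMul_vecMul, Matrix.mul_nonsing_inv _ hMu, Matrix.vecMul_one] at h2
      exact h2
    rw [← Matrix.cramer_transpose_apply, hcr, Pi.smul_apply, smul_eq_mul]
  have hDm : (Matrix.of fun l l' : Fin m => (M.updateRow (idx l) (c l')).det) =
      M.det • (Matrix.of fun l l' : Fin m => X l (idx l')).transpose := by
    ext l l'
    simp only [Matrix.of_apply, hD, Matrix.smul_apply, Matrix.transpose_apply, smul_eq_mul]
  rw [hDm, Matrix.det_smul, Matrix.det_transpose, Fintype.card_fin, hdetN]
  ring

end Field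

/-! ## The m-parameter table -/

variable {ι : Type} [Fintype ι] [DecidableEq ι]

/-- the m-parameter table `I + Σ_l ε_l N_l`. -/
abbrev tabM {m : ℕ} (N : Fin m → ι → ι → ℂ) (ε : Fin m → ℂ) : ι → ι → ℂ :=
  fun a q => (if q = a then 1 else 0) + ∑ l, ε l * N l a q

/-- the same with generic parameters in `ℂ[ε_1, …, ε_m]`. -/
abbrev tabRM {m : ℕ} (N : Fin m → ι → ι → ℂ) : ι → ι → MvPolynomial (Fin m) ℂ :=
  fun a q => MvPolynomial.C (if q = a then 1 else 0) + ∑ l, MvPolynomial.X l * MvPolynomial.C (N l a q)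

omit [Fintype ι] in
/-- evaluation of the generic determinant. -/
theorem eval_det_mat_tabRM {m : ℕ} (N : Fin m → ι → ι → ℂ) {r : ℕ} (u colJ : Fin r → Finset ι) (ε : Fin m → ℂ) :
    MvPolynomial.eval ε (mat (tabRM N) u colJ).det = (mat (tabM N ε) u colJ).det := by
  rw [RingHom.map_det, RingHom.mapMatrix_apply]
  congr 1
  ext i kk
  simp only [mat, Matrix.map_apply, Matrix.of_apply, map_prod, map_sum, tabRM, tabM, map_add, map_mul,
    MvPolynomial.eval_C, MvPolynomial.eval_X]

omit [Fintype ι] in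
/-- at `ε = 0` the monomial matrix is the inclusion matrix `[b i ⊆ colJ kk]`. -/
theorem mat_tabM_zero {m : ℕ} (N : Fin m → ι → ι → ℂ) {r : ℕ} (b colJ : Fin r → Finset ι) (i kk : Fin r) :
    mat (tabM N 0) b colJ i kk = if b i ⊆ colJ kk then 1 else 0 := by
  classical
  simp only [mat, Matrix.of_apply, tabM, Pi.zero_apply, zero_mul, Finset.sum_const_zero, add_zero, Finset.sum_ite_eq',
    Finset.prod_boole]
  rfl

omit [Fintype ι] in
/-- **the inclusion matrix of the ball is nonsingular**: injective rows of size `≤ t` against columns covering all points of size `≤ t`. -/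
theorem det_incl_ne_zero {m : ℕ} (N : Fin m → ι → ι → ℂ) (t : ℕ) {r : ℕ} (b colJ : Fin r → Finset ι)
    (hinj : Function.Injective b) (hb : ∀ i, (b i).card ≤ t) (hcol : ∀ J : Finset ι, J.card ≤ t → ∃ kk, colJ kk = J) :
    (mat (tabM N 0) b colJ).det ≠ 0 := by
  classical
  set M := mat (tabM N 0) b colJ with hM
  suffices h : Function.Injective M.vecMul by
    have hu : IsUnit M := Matrix.vecMul_injective_iff_isUnit.1 h
    rw [Matrix.isUnit_iff_isUnit_det, isUnit_iff_ne_zero] at hu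
    exact hu
  refine (injective_iff_map_eq_zero (Matrix.vecMulLinear M)).2 fun c hc => ?_
  change Matrix.vecMul c M = 0 at hc
  let g : Finset ι → ℂ := fun R => ∑ i ∈ Finset.univ.filter (fun i => b i = R), c i
  have hg : ∀ R : Finset ι, R.card ≤ t → g R = 0 := by
    apply moebius_zero
    intro J hJ
    obtain ⟨kk, hkk⟩ := hcol J hJ
    have hck : (Matrix.vecMul c M) kk = 0 := by rw [hc]; rfl
    rw [Matrix.vecMul, dotProduct] at hck
    rw [← hck]
    symm
    calc ∑ i, c i * M i kk = ∑ i, c i * (if b i ⊆ J then 1 else 0) :=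
          Finset.sum_congr rfl fun i _ => by rw [hM, mat_tabM_zero, hkk]
      _ = ∑ i ∈ Finset.univ.filter (fun i => b i ⊆ J), c i := by
          rw [Finset.sum_filter]; exact Finset.sum_congr rfl fun i _ => by split_ifs <;> simp
      _ = ∑ R ∈ J.powerset, g R := by
          rw [← Finset.sum_fiberwise_of_maps_to (s := Finset.univ.filter (fun i => b i ⊆ J)) (t := J.powerset) (g := b)
            (fun i hi => Finset.mem_powerset.2 (Finset.mem_filter.1 hi).2)]
          refine Finset.sum_congr rfl fun R hR => ?_
          simp only [g]
          refine Finset.sum_congr ?_ fun _ _ => rfl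
          ext i
          simp only [Finset.mem_filter, Finset.mem_univ, true_and]
          constructor
          · rintro ⟨-, h⟩; exact h
          · intro h; exact ⟨h ▸ Finset.mem_powerset.1 hR, h⟩
  funext i
  have hgi : g (b i) = c i := by
    have : Finset.univ.filter (fun i' => b i' = b i) = {i} := by
      ext i'
      simp only [Finset.mem_filter, Finset.mem_univ, true_and, Finset.mem_singleton]
      exact ⟨fun h => hinj h, fun h => by rw [h]⟩
    simp only [g, this, Finset.sum_singleton]
  rw [← hgi, hg (b i) (hb i)]
  rfl

/-! ## The replaced row family and the polynomial identity -/

/-- the row family `b` with the slots `idx l` replaced by `C l`. -/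
def replaced {r m : ℕ} (b : Fin r → Finset ι) (idx : Fin m → Fin r) (C : Fin m → Finset ι) : Fin r → Finset ι :=
  fun i => if h : ∃ l, idx l = i then C (Classical.choose h) else b i

omit [Fintype ι] [DecidableEq ι] in
/-- the replaced family at a slot. -/
theorem replaced_idx {r m : ℕ} (b : Fin r → Finset ι) {idx : Fin m → Fin r} (hidx : Function.Injective idx)
    (C : Fin m → Finset ι) (l : Fin m) : replaced b idx C (idx l) = C l := by
  have h : ∃ l', idx l' = idx l := ⟨l, rfl⟩
  simp only [replaced, dif_pos h]
  rw [hidx (Classical.choose_spec h)]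

omit [Fintype ι] [DecidableEq ι] in
/-- the replaced family off the slots. -/
theorem replaced_other {r m : ℕ} (b : Fin r → Finset ι) (idx : Fin m → Fin r) (C : Fin m → Finset ι) {i : Fin r}
    (hi : ∀ l, idx l ≠ i) : replaced b idx C i = b i := by
  have hne : ¬ ∃ l, idx l = i := fun ⟨l, h⟩ => hi l h
  simp only [replaced, dif_neg hne]

omit [Fintype ι] in
/-- the m-row exchange identity, pointwise over `ℂ` (trivially true where `D_B = 0` since `m ≥ 1`). -/
theorem det_mul_det_oneRow_eq_tabM {m : ℕ} (hm : 0 < m) (N : Fin m → ι → ι → ℂ) {r : ℕ} (b colJ : Fin r → Finset ι)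
    {idx : Fin m → Fin r} (hidx : Function.Injective idx) (C : Fin m → Finset ι) (ε : Fin m → ℂ) :
    (mat (tabM N ε) b colJ).det *
        (Matrix.of fun l l' : Fin m => (mat (tabM N ε) (Function.update b (idx l) (C l')) colJ).det).det =
      (mat (tabM N ε) b colJ).det ^ m * (mat (tabM N ε) (replaced b idx C) colJ).det := by
  classical
  by_cases hB : (mat (tabM N ε) b colJ).det = 0
  · rw [hB, zero_mul, zero_pow (Nat.pos_iff_ne_zero.1 hm), zero_mul]
  have h1 : (Matrix.of fun l l' : Fin m => (mat (tabM N ε) (Function.update b (idx l) (C l')) colJ).det) =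
      Matrix.of fun l l' : Fin m => ((mat (tabM N ε) b colJ).updateRow (idx l)
        (fun kk => ∏ a ∈ C l', ∑ q ∈ colJ kk, tabM N ε a q)).det := by
    ext l l'; rw [Matrix.of_apply, Matrix.of_apply, mat_update]
  rw [h1]
  refine det_mul_det_oneRow_eq _ hB idx hidx _ _ (fun i hi => ?_) (fun l => ?_)
  · funext kk; simp only [mat, Matrix.of_apply, replaced_other b idx C hi]
  · funext kk; simp only [mat, Matrix.of_apply, replaced_idx b hidx C l]

omit [Fintype ι] in
/-- the m-row exchange identity in `ℂ[ε]`. -/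
theorem detRM_identity {m : ℕ} (hm : 0 < m) (N : Fin m → ι → ι → ℂ) {r : ℕ} (b colJ : Fin r → Finset ι)
    {idx : Fin m → Fin r} (hidx : Function.Injective idx) (C : Fin m → Finset ι) :
    (mat (tabRM N) b colJ).det *
        (Matrix.of fun l l' : Fin m => (mat (tabRM N) (Function.update b (idx l) (C l')) colJ).det).det =
      (mat (tabRM N) b colJ).det ^ m * (mat (tabRM N) (replaced b idx C) colJ).det := by
  classical
  apply MvPolynomial.funext
  intro ε
  have hD : MvPolynomial.eval ε (Matrix.of fun l l' : Fin m => (mat (tabRM N) (Function.update b (idx l) (C l')) colJ).det).det =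
      (Matrix.of fun l l' : Fin m => (mat (tabM N ε) (Function.update b (idx l) (C l')) colJ).det).det := by
    rw [RingHom.map_det, RingHom.mapMatrix_apply]
    congr 1; ext l l'; simp only [Matrix.map_apply, Matrix.of_apply, eval_det_mat_tabRM]
  rw [map_mul, map_mul, map_pow, eval_det_mat_tabRM, eval_det_mat_tabRM, hD]
  exact det_mul_det_oneRow_eq_tabM hm N b colJ hidx C ε

/-! ## ★ The m-swap composition theorem -/

omit [Fintype ι] in
/-- ★ **m-SWAP EXCHANGE COMPOSITION.**  Base enumeration `b` (injective, sizes `≤ t`), columns covering the points of size `≤ t`, distinct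
slots `idx`, new rows `C`, m-parameter table `I + Σ ε_l N_l`.  If each diagonal one-row minor is nonzero at `ε = e_l` and every
non-identity permutation of the slots meets an identically vanishing one-row minor, then the fully replaced family is served for some `ε`. -/
theorem exists_params_of_unique_matching {m : ℕ} (hm : 0 < m) (N : Fin m → ι → ι → ℂ) (t : ℕ) {r : ℕ}
    (b colJ : Fin r → Finset ι) (hinj : Function.Injective b) (hb : ∀ i, (b i).card ≤ t)
    (hcol : ∀ J : Finset ι, J.card ≤ t → ∃ kk, colJ kk = J)
    {idx : Fin m → Fin r} (hidx : Function.Injective idx) (C : Fin m → Finset ι)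
    (hdiag : ∀ l, (mat (tabM N (Pi.single l 1)) (Function.update b (idx l) (C l)) colJ).det ≠ 0)
    (hzero : ∀ σ : Equiv.Perm (Fin m), σ ≠ 1 →
      ∃ l, ∀ ε, (mat (tabM N ε) (Function.update b (idx l) (C (σ l))) colJ).det = 0) :
    ∃ ε : Fin m → ℂ, (mat (tabM N ε) (replaced b idx C) colJ).det ≠ 0 := by
  classical
  set PD : Matrix (Fin m) (Fin m) (MvPolynomial (Fin m) ℂ) :=
    Matrix.of fun l l' : Fin m => (mat (tabRM N) (Function.update b (idx l) (C l')) colJ).det with hPD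
  have hid := detRM_identity hm N b colJ hidx C
  -- the determinant of the one-row minors is the product of the diagonal
  have hdet : PD.det = ∏ l, PD l l := by
    rw [Matrix.det_apply, Finset.sum_eq_single (1 : Equiv.Perm (Fin m))]
    · simp
    · intro σ _ hσ
      obtain ⟨l, hl⟩ := hzero σ⁻¹ (by simpa using hσ)
      set j := σ⁻¹ l with hj
      have hσj : σ j = l := by simp [hj]
      have h0 : PD (σ j) j = 0 := by
        have h1 : PD (σ j) j = (mat (tabRM N) (Function.update b (idx (σ j)) (C j)) colJ).det := by
          simp only [hPD, Matrix.of_apply]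
        rw [h1, hσj]
        apply MvPolynomial.funext; intro ε
        rw [map_zero, eval_det_mat_tabRM]; exact hl ε
      have hprod : ∏ i, PD (σ i) i = 0 := Finset.prod_eq_zero (Finset.mem_univ j) h0
      rw [hprod, smul_zero]
    · intro h; exact (h (Finset.mem_univ _)).elim
  have hdiag' : ∀ l, PD l l ≠ 0 := by
    intro l h0
    apply hdiag l
    rw [← eval_det_mat_tabRM, ← Matrix.of_apply (f := fun l l' : Fin m =>
      (mat (tabRM N) (Function.update b (idx l) (C l')) colJ).det) (i := l) (j := l), ← hPD, h0, map_zero]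
  have hPDne : PD.det ≠ 0 := by rw [hdet]; exact Finset.prod_ne_zero_iff.2 fun l _ => hdiag' l
  have hPB : (mat (tabRM N) b colJ).det ≠ 0 := by
    intro h0
    apply det_incl_ne_zero N t b colJ hinj hb hcol
    rw [← eval_det_mat_tabRM, h0, map_zero]
  have hPU : (mat (tabRM N) (replaced b idx C) colJ).det ≠ 0 := by
    intro h0
    rw [← hPD, h0, mul_zero] at hid
    exact mul_ne_zero hPB hPDne hid
  by_contra hall
  push Not at hall
  apply hPU
  apply MvPolynomial.funext
  intro ε
  rw [map_zero, eval_det_mat_tabRM]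
  exact hall ε

omit [Fintype ι] in
/-- ★ **Item-currency form.** -/
theorem exists_table_of_unique_matching {m : ℕ} (hm : 0 < m) (N : Fin m → ι → ι → ℂ) (t : ℕ) {r : ℕ}
    (b colJ : Fin r → Finset ι) (hinj : Function.Injective b) (hb : ∀ i, (b i).card ≤ t)
    (hcol : ∀ J : Finset ι, J.card ≤ t → ∃ kk, colJ kk = J)
    {idx : Fin m → Fin r} (hidx : Function.Injective idx) (C : Fin m → Finset ι)
    (hdiag : ∀ l, (mat (tabM N (Pi.single l 1)) (Function.update b (idx l) (C l)) colJ).det ≠ 0)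
    (hzero : ∀ σ : Equiv.Perm (Fin m), σ ≠ 1 →
      ∃ l, ∀ ε, (mat (tabM N ε) (Function.update b (idx l) (C (σ l))) colJ).det = 0) :
    ∃ tx : Option ι → ι → ℂ,
      (Matrix.of fun i kk : Fin r => ∏ a ∈ replaced b idx C i, (tx none a + ∑ q ∈ colJ kk, tx (some q) a)).det ≠ 0 := by
  obtain ⟨ε, hε⟩ := exists_params_of_unique_matching hm N t b colJ hinj hb hcol hidx C hdiag hzero
  refine ⟨fun o a => match o with | none => 0 | some q => tabM N ε a q, ?_⟩
  simpa [mat, zero_add] using hε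

end SecondShell

end

end Summit.ValiantsHypothesis.ValiantsHypothesis.Theorems.BarrierLever.HiddenStates
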